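import Literature.AnabelianGeometry.AbsoluteAnabelian.AbsTopIII.FrobeniusPictureMLFTelecoreNecessity
import Mathlib.CategoryTheory.SingleObj
import Mathlib.CategoryTheory.Groupoid
import Mathlib.Data.ZMod.Basic
import HarnessLib

/-!
# [AbsTopIII] Cor. 3.6 (ii) as typed is NOT a tautology: a kernel countermodel for incoherent telecore data

S. Mochizuki, *Topics in Absolute Anabelian Geometry III*, Cor. 3.6 (ii) pp. 79–80 (kurims manuscript
`paper:url-5493eb38cbb7`; bib key `MochizukiAbsTopIII2015`).  PROOF-ONLY file (abc-iut cell, seat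
abc-iut-w5-d061, RQ7 audit by-product of `FrobeniusPictureMLFTelecoreProofs/Necessity/Construction`);
no notion is declared.

The tree proves the typed Cor. 3.6 (ii), `LogFrobeniusData.TelecoreStmt τ`, for every abstract datum with
fully faithful `id_⋎` and COHERENT first-row telecore data `τ = (φ_⋎, e, η_⋎)`
(`telecoreStmt_of_coherent`, seat abc-iut-L4-t5), and proves that coherence is NECESSARY on the essential
image of `φ_⋎` (`coherent_of_telecoreStmt`).  `LogFrobeniusToyWitness.lean` (seat abc-iut-w5-d210) shows the
hypothesis lists are jointly SATISFIABLE.  This file records the complementary kernel fact: the typed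
statement is FALSIFIABLE — there is an abstract log-Frobenius datum (all six categories the one-object
groupoid of `G = ℤ/2`, all functors identities, `η_An` and `η_⋎` the unitors) and a telecore datum whose
identification `e : id_⋎ ∘ φ_⋎ ≅ φ_□` is twisted by the central element `g ≠ 1`, at which `TelecoreStmt`
FAILS (the forced coherence equation reads `1 = g`), although `id_⋎ = 𝟭` is fully faithful.  So the
data `e`, `η_⋎` of `TelecoreData` and the hypothesis `hτ` of `telecoreStmt_of_coherent` carry content:
the printed sentence "`η_{□⋎}` the IDENTITY natural transformation … `η_⋏` the isomorphism ARISING FROM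
`η_An`" (p. 80) is used essentially.  A toy, not the geometric data; nothing here bears on [IUTchIII]
Cor. 3.12 or takes a side; refereed pre-IUT material.
-/

namespace Literature.AnabelianGeometry.AbsoluteAnabelian.AbsTopIII

open _root_.CategoryTheory

/-- **The typed [AbsTopIII] Cor. 3.6 (ii) (`TelecoreStmt`) is falsifiable for incoherent telecore data**:
there are `Δ : LogFrobeniusData` with `id_⋎` fully faithful and `τ : Δ.TelecoreData` with
`¬ Δ.TelecoreStmt τ` (one-object groupoid of `ℤ/2`, `e` twisted by the non-trivial central element; the
coherence equation forced by `coherent_of_telecoreStmt` is `1 = g`).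
[cite: MochizukiAbsTopIII2015, Corollary 3.6 (ii) pp.79–80] -/
theorem exists_not_telecoreStmt :
    ∃ (Δ : LogFrobeniusData.{0}) (τ : Δ.TelecoreData),
      Nonempty Δ.toNexus.FullyFaithful ∧ ¬ Δ.TelecoreStmt τ := by
  let G2 : Type := Multiplicative (ZMod 2)
  let Δ : LogFrobeniusData.{0} :=
    { X₁ := SingleObj G2, X := SingleObj G2, toNexus := 𝟭 _, N := SingleObj G2, E := SingleObj G2,
      A := SingleObj G2, log := 𝟭 _, logIsoId := Iso.refl _, lamTimes := 𝟭 _, lamPf := 𝟭 _,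
      ιlog := (Functor.rightUnitor (𝟭 (SingleObj G2) ⋙ 𝟭 (SingleObj G2))).hom, ιtimes := Sum.inl (𝟙 _),
      XtoE := 𝟭 _, NtoE := 𝟭 _, lamTimes_NtoE := Functor.comp_id _, lamPf_NtoE := Functor.comp_id _,
      κ := 𝟭 _, AtoE := 𝟭 _, κ_equiv := inferInstance, κ_inv := Functor.rightUnitor _,
      φ := 𝟭 _, φ_equiv := inferInstance, η := Functor.rightUnitor _ ≪≫ Functor.rightUnitor _ }
  -- the non-trivial central automorphism `g` of the unique object
  let g : (SingleObj.star G2) ≅ (SingleObj.star G2) :=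
    (Groupoid.isoEquivHom (SingleObj.star G2) (SingleObj.star G2)).symm (Multiplicative.ofAdd (1 : ZMod 2))
  have hg : g.hom = Multiplicative.ofAdd (1 : ZMod 2) := rfl
  -- the twisted telecore datum
  let τ : Δ.TelecoreData :=
    { φ₁ := 𝟭 _
      e := NatIso.ofComponents (fun _ => g) (fun {X Y} f => by
        simp only [Functor.comp_map, Functor.id_map, hg]
        exact mul_comm (Multiplicative.ofAdd (1 : ZMod 2) : G2) (f : G2))
      η₁ := Functor.rightUnitor _ ≪≫ Functor.rightUnitor _ ≪≫ Functor.rightUnitor _ }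
  refine ⟨Δ, τ, ⟨Functor.FullyFaithful.id _⟩, fun h => ?_⟩
  have key := Δ.coherent_of_telecoreStmt τ h (SingleObj.star G2)
  simp only [Δ, τ, Functor.id_obj, Functor.id_map, Iso.trans_hom, NatTrans.comp_app,
    Functor.rightUnitor_hom_app, NatIso.ofComponents_hom_app, hg] at key
  -- `key : 𝟙 ⋆ = g`
  have k3 : (Multiplicative.ofAdd (1 : ZMod 2) : G2) = 1 := by
    rw [← SingleObj.id_as_one G2 (SingleObj.star G2)]; exact key.symm
  exact absurd (Multiplicative.ofAdd.injective (k3.trans ofAdd_zero.symm)) (by decide)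

end Literature.AnabelianGeometry.AbsoluteAnabelian.AbsTopIII
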